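import Mathlib
import HarnessLib

/-!
# Decreasing families of subgroups of a finite group along a directed system stabilise
# (crux `WildQuotients.WildQuotientResolution`, stub `stub_phaseZeroHighDim`: the "limit inertia" step of the
# Zariski-local port of (H1))

Crux stmt-ResolutionOfSingularities-15640 (`WildQuotientResolution`), registered stub `stub_phaseZeroHighDim`,
residual (H1) = Abbes–Saito 2011 Prop. 2.22. Along the cofiltered system of normalised `U`-admissible models
`ψ` and a chain of points `(y_ψ)`, the inertia groups `I(y_ψ) ≤ G` DECREASE (✓`InertiaLe.stub_inertia_le`,
AS Lemma 2.15); since `G` is finite they are eventually CONSTANT, equal to the limiting inertia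
`I_∞ = ⨅_ψ I(y_ψ)` — this replaces the `π₀`-limit argument (EGA IV 8.4.1) of the printed proof (evidence memo
PHASE0-H1-PORTPLAN.md §2b). This file is the order-theoretic fact:

* `exists_eventually_eq_iInf` — an antitone family `f : ι → Subgroup G` over a directed index set, `G` finite,
  is eventually constant with value `⨅ i, f i`.

[OURS · crux stmt-ResolutionOfSingularities-15640 · helper toward `stub_phaseZeroHighDim`; counted 0; AI-level work,
weaker than expert review.] [folklore]
-/

-- single-problem summit: the doubled namespace component `ResolutionOfSingularities` is forced
set_option linter.dupNamespace false

namespace Summit.ResolutionOfSingularities.ResolutionOfSingularities.Theorems.WildQuotientResolution.LimitInertia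

universe u v

/-- **Antitone families of subgroups of a finite group over a directed set stabilise at their infimum.**
[folklore] -/
theorem exists_eventually_eq_iInf {ι : Type v} [Preorder ι] [IsDirectedOrder ι] [Nonempty ι]
    {G : Type u} [Group G] [Finite G] (f : ι → Subgroup G) (hf : Antitone f) :
    ∃ i₀ : ι, (∀ j, i₀ ≤ j → f j = f i₀) ∧ f i₀ = ⨅ i, f i := by
  haveI : Finite (Subgroup G) :=
    Finite.of_injective (fun H : Subgroup G => (H : Set G)) fun _ _ h => SetLike.coe_injective h
  obtain ⟨i⟩ := ‹Nonempty ι›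
  obtain ⟨m, ⟨i₀, rfl⟩, hmin⟩ :=
    WellFounded.has_min wellFounded_lt (Set.range f) ⟨f i, i, rfl⟩
  have hconst : ∀ j, i₀ ≤ j → f j = f i₀ := fun j hj =>
    (eq_of_le_of_not_lt (hf hj) (hmin (f j) ⟨j, rfl⟩))
  refine ⟨i₀, hconst, le_antisymm (le_iInf fun k => ?_) (iInf_le f i₀)⟩
  obtain ⟨l, hkl, hil⟩ := exists_ge_ge k i₀
  rw [← hconst l hil]
  exact hf hkl

/-- The same for an antitone family indexed by `ℕ` (a tower of blow-ups). [folklore] -/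
theorem exists_eventually_eq_iInf_nat {G : Type u} [Group G] [Finite G] (f : ℕ → Subgroup G)
    (hf : Antitone f) : ∃ n₀ : ℕ, (∀ n, n₀ ≤ n → f n = f n₀) ∧ f n₀ = ⨅ n, f n :=
  exists_eventually_eq_iInf f hf

end Summit.ResolutionOfSingularities.ResolutionOfSingularities.Theorems.WildQuotientResolution.LimitInertia
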